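import Literature.MathematicalPhysics.QuantumLattice.DWaveOrderParameterProofs
import Literature.MathematicalPhysics.QuantumLattice.DWaveSourceFreeGainBound
import Literature.MathematicalPhysics.QuantumLattice.LiebFluxPhaseProofs
import Literature.MathematicalPhysics.QuantumLattice.HubbardGaugeBound

/-!
# Crux `NodalReduction` (item `stmt-HubbardSuperconductivity-1268`): the weak-coupling CEILING on the
`d`-wave order parameter — the free torus is orderless, `m(U,μ) → 0` as `U → 0⁺`, two strengthenings refuted

Support lemmas from the standing disprover (generation 1) of `Theses.NodalWardXY.NodalReduction`, whose
content is the weak-coupling window `∃ δ ∈ (0,1/2) ∃ U₀ > 0 ∀ U ∈ (0,U₀) ∃ μ : DensityMatched ∧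
HasDWaveOrder U μ`. Nothing here asserts a Theses declaration; everything is about the tree's Koma–Tasaki
objects `dWaveSourceTorus`, `dWaveSourceDensity`, `dWaveOrderParameter`, `HasDWaveOrder` at `U ≥ 0`:

* `groundEnergy_add_le` / `groundEnergy_le_add` — operator-norm stability `|E₀(A + X) - E₀(A)| ≤ ‖X‖`
  (trial-state comparison for the tracial ground state);
* `dWaveSourceTorus_eq_add_smul`, `norm_doubleOcc_le` — `H_{L,h}(U) = H_{L,h}(0) + U·D`,
  `D = Σ_x n_{x↑}n_{x↓}`, `‖D‖ ≤ L²`;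
* `density_le_free` — **`dWaveSourceDensity L U μ h ≤ 2·dWaveSourceDensity L 0 μ (2h) + U/h`** for all
  `L, μ`, `U ≥ 0`, `h > 0` (Koma–Tasaki energy sandwich of the tree + the two items above);
* `free_gain_le`, `free_density_le_sqrt` — the FREE sourced energy gain
  `E_L(0,μ,0) - E_L(0,μ,s) ≤ (C₀(1 + log β)s² + 2 log 2/β)L²` (landed BdG pressure gain
  `dWaveSource_free_sourcedGain_le` + `e^{-βE₀} ≤ Re Z_β ≤ 4^{L²}e^{-βE₀}`), hence the free sourced pair
  density is `≤ K√s` for `s ∈ (0,1]`, uniformly on compacts `[μ₁,μ₂] ⊂ (-4,0)` (crude form of the Cooper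
  law `∼ s log(1/s)`);
* `orderParameter_le_weakCoupling` — **`dWaveOrderParameter U μ ≤ 2K√(2h) + U/h`** (`U ≥ 0`,
  `μ ∈ [μ₁,μ₂]`, `h ∈ (0,1/2]`), so `m(U,μ) = O(U^{1/3})`;
* `dWaveOrderParameter_free_eq_zero`, `not_hasDWaveOrder_free` — **the free torus has no `d`-wave
  Koma–Tasaki order** for `μ ∈ (-4,0)`;
* `orderParameter_small_of_weakCoupling` — `m(U,μ) ≤ ε` for all `U ∈ [0,U₀(ε))`, uniformly in
  `μ ∈ [μ₁,μ₂]`;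
* REFUTED STRENGTHENINGS of the window: `window_false_fromZero` (coupling interval closed at `U = 0`) and
  `window_false_uniformOrder` (a `U`-uniform floor `m₀ > 0` on the order parameter), both with the chemical
  potential confined to a compact of the hole-doped free band.

Consequence recorded for provers of the crux: the window is a window of parametrically WEAK order —
`m(U, μ_U) → 0` as `U → 0⁺` is forced (consistent with, and untouched by, the sibling floor `exp(-C/U²)` of
`WeakCouplingBCS.WcbcsBcsConstruction`).

Sources: T. Koma, H. Tasaki, J. Stat. Phys. 76 (1994) 745, §1 (order parameter through an infinitesimal
source; variational inequalities) [KomaTasaki1994]; E. H. Lieb, Phys. Rev. Lett. 73 (1994) 2158, Remark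
(iii) (`β → ∞` from partition functions to ground energies) [Lieb1994]; M. Salmhofer, *Renormalization*
(1999) §4.5.4 (the Cooper logarithm of the free pair susceptibility) [Salmhofer1999]. Tree:
`dWaveSource_free_sourcedGain_le` (`DWaveSourceFreeGainBound`), `exp_neg_mul_groundEnergy_le_partitionFn`,
`partitionFn_le_card_mul_exp` (`LiebFluxPhaseProofs`), `dWaveSourceDensity_le_energyDrop_div`,
`dWaveOrderParameter_le_liminf`, `dWaveOrderParameter_nonneg` (`DWaveOrderParameterProofs`),
`groundEnergy_dWaveSourceTorus_le`, `groundEnergy_gain_le_dWaveSourceDensity`,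
`dWaveSourceDensity_mul_le_groundEnergy_drop` (`DWaveSourceProofs`),
`groundEnergy_le_groundStateFunctional_re`, `abs_re_groundStateFunctional_le_norm` (tracial ground state).
-/

noncomputable section

set_option linter.dupNamespace false

namespace Summit.HubbardSuperconductivity.HubbardSuperconductivity.Theorems.NodalReduction.Negative

open Filter Set Matrix Literature.MathematicalPhysics.QuantumLattice Literature.Probability.LatticeModels
open scoped Topology Matrix.Norms.L2Operator ComplexOrder

/-! ### Operator-norm stability of the ground energy -/

section Perturb

variable {n : Type*} [Fintype n] [DecidableEq n] [Nonempty n]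

/-- `E₀(A + X) ≤ E₀(A) + ‖X‖` for Hermitian `A, X` (the ground state of `A` as trial state,
`|Re ω_A(X)| ≤ ‖X‖`). [cite: Tasaki2020, §2.1] -/
theorem groundEnergy_add_le {A X : Matrix n n ℂ} (hA : A.IsHermitian) (hX : X.IsHermitian) :
    (A + X).groundEnergy ≤ A.groundEnergy + ‖X‖ := by
  have h := groundEnergy_le_groundStateFunctional_re hA (hA.add hX)
  rw [map_add, Complex.add_re, groundStateFunctional_hamiltonian hA, Complex.ofReal_re] at h
  have h2 := (le_abs_self _).trans (abs_re_groundStateFunctional_le_norm hA X)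
  linarith

/-- `E₀(A) ≤ E₀(A + X) + ‖X‖` for Hermitian `A, X`. [cite: Tasaki2020, §2.1] -/
theorem groundEnergy_le_add {A X : Matrix n n ℂ} (hA : A.IsHermitian) (hX : X.IsHermitian) :
    A.groundEnergy ≤ (A + X).groundEnergy + ‖X‖ := by
  have h := groundEnergy_add_le (hA.add hX) hX.neg
  rwa [add_neg_cancel_right, norm_neg] at h

end Perturb

/-! ### The coupling as a bounded perturbation of the sourced torus Hamiltonian -/

/-- `H_{L,h}(U) = H_{L,h}(0) + U·Σ_x n_{x↑}n_{x↓}`: the coupling enters the sourced Hamiltonian linearly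
through the double-occupancy operator. [folklore] -/
theorem dWaveSourceTorus_eq_add_smul (L : ℕ) [NeZero L] (U μ s : ℝ) :
    dWaveSourceTorus L U μ s = dWaveSourceTorus L 0 μ s +
      (U : ℂ) • ∑ x : FermionTorus 2 L, numberOp x 0 * numberOp x 1 := by
  simp only [dWaveSourceTorus, hubbardTorusWith, hamiltonianWith, hamiltonian]
  push_cast
  simp only [zero_smul, add_zero]
  abel

/-- `‖n_{xσ}‖ ≤ 1` (`‖c†‖, ‖c‖ ≤ 1`). [folklore] -/
theorem norm_numberOp_le_one' {Λ : Type*} [LinearOrder Λ] [Fintype Λ] (x : Λ) (σ : Fin 2) :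
    ‖(numberOp x σ : Matrix (Finset (Orb Λ)) (Finset (Orb Λ)) ℂ)‖ ≤ 1 :=
  (norm_mul_le _ _).trans (mul_le_one₀ (norm_creation_le_one _) (norm_nonneg _)
    (norm_annihilation_le_one _))

/-- `‖Σ_x n_{x↑}n_{x↓}‖ ≤ L²` on the torus of side `L`. [folklore] -/
theorem norm_doubleOcc_le (L : ℕ) :
    ‖(∑ x : FermionTorus 2 L, numberOp x 0 * numberOp x 1 :
      Matrix (Finset (Orb (FermionTorus 2 L))) (Finset (Orb (FermionTorus 2 L))) ℂ)‖ ≤ (L : ℝ) ^ 2 := by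
  calc ‖∑ x : FermionTorus 2 L, numberOp x 0 * numberOp x 1‖
      ≤ ∑ x : FermionTorus 2 L, ‖(numberOp x 0 * numberOp x 1 :
          Matrix (Finset (Orb (FermionTorus 2 L))) (Finset (Orb (FermionTorus 2 L))) ℂ)‖ :=
        norm_sum_le _ _
    _ ≤ ∑ _x : FermionTorus 2 L, (1 : ℝ) := Finset.sum_le_sum fun x _ =>
        (norm_mul_le _ _).trans
          (mul_le_one₀ (norm_numberOp_le_one' x 0) (norm_nonneg _) (norm_numberOp_le_one' x 1))
    _ = (L : ℝ) ^ 2 := by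
        simp [FermionTorus, Fintype.card_lex]

/-- **Weak-coupling comparison of sourced pair densities** (every finite `L`, every `μ`, `U ≥ 0`, `h > 0`):
`dWaveSourceDensity L U μ h ≤ 2 · dWaveSourceDensity L 0 μ (2h) + U/h` — the interacting response at source
`h` is controlled by the FREE response at source `2h` plus `U/h` (energy sandwich + `|ΔE₀| ≤ U L²`).
[cite: KomaTasaki1994, §1] -/
theorem density_le_free {L : ℕ} [NeZero L] {U : ℝ} (hU : 0 ≤ U) (μ : ℝ) {h : ℝ} (hh : 0 < h) :
    dWaveSourceDensity L U μ h ≤ 2 * dWaveSourceDensity L 0 μ (2 * h) + U / h := by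
  have hK0 : ∀ s, (dWaveSourceTorus L 0 μ s).IsHermitian := fun s =>
    dWaveSourceTorus_isHermitian L (isHermitian_hubbardTorusWith L 1 0 μ) s
  have hKU : ∀ s, (dWaveSourceTorus L U μ s).IsHermitian := fun s =>
    dWaveSourceTorus_isHermitian L (isHermitian_hubbardTorusWith L 1 U μ) s
  have hX : ((U : ℂ) • ∑ x : FermionTorus 2 L, numberOp x 0 * numberOp x 1 :
      Matrix (Finset (Orb (FermionTorus 2 L))) (Finset (Orb (FermionTorus 2 L))) ℂ).IsHermitian := by
    have := (hKU h).sub (hK0 h)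
    rwa [dWaveSourceTorus_eq_add_smul L U μ h, add_sub_cancel_left] at this
  have hXnorm : ‖((U : ℂ) • ∑ x : FermionTorus 2 L, numberOp x 0 * numberOp x 1 :
      Matrix (Finset (Orb (FermionTorus 2 L))) (Finset (Orb (FermionTorus 2 L))) ℂ)‖ ≤ U * (L : ℝ) ^ 2 := by
    rw [norm_smul, Complex.norm_real, Real.norm_eq_abs, abs_of_nonneg hU]
    exact mul_le_mul_of_nonneg_left (norm_doubleOcc_le L) hU
  have e1 : (dWaveSourceTorus L U μ h).groundEnergy ≤
      (dWaveSourceTorus L 0 μ h).groundEnergy + U * (L : ℝ) ^ 2 := by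
    rw [dWaveSourceTorus_eq_add_smul L U μ h]
    exact (groundEnergy_add_le (hK0 h) hX).trans (by linarith)
  have e2 : (dWaveSourceTorus L 0 μ (2 * h)).groundEnergy ≤
      (dWaveSourceTorus L U μ (2 * h)).groundEnergy + U * (L : ℝ) ^ 2 := by
    have := groundEnergy_le_add (hK0 (2 * h)) hX
    rw [← dWaveSourceTorus_eq_add_smul L U μ (2 * h)] at this
    linarith
  have e3 := groundEnergy_dWaveSourceTorus_le (L := L) 0 μ h
  have e4 := groundEnergy_gain_le_dWaveSourceDensity (L := L) 0 μ (2 * h)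
  have e5 := dWaveSourceDensity_mul_le_groundEnergy_drop (L := L) U μ h (2 * h)
  have hL := cast_sq_pos_of_neZero L
  have hpos : (0 : ℝ) < 2 * h * (L : ℝ) ^ 2 := by positivity
  have key : h * (2 * (L : ℝ) ^ 2 * dWaveSourceDensity L U μ h) ≤
      2 * (2 * h) * (L : ℝ) ^ 2 * dWaveSourceDensity L 0 μ (2 * h) + 2 * U * (L : ℝ) ^ 2 := by
    have e5' : h * (2 * (L : ℝ) ^ 2 * dWaveSourceDensity L U μ h) ≤
        (dWaveSourceTorus L U μ h).groundEnergy - (dWaveSourceTorus L U μ (2 * h)).groundEnergy := by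
      have : (2 * h - h) = h := by ring
      rw [this] at e5
      exact e5
    linarith
  refine le_of_mul_le_mul_right ?_ hpos
  calc dWaveSourceDensity L U μ h * (2 * h * (L : ℝ) ^ 2)
      = h * (2 * (L : ℝ) ^ 2 * dWaveSourceDensity L U μ h) := by ring
    _ ≤ 2 * (2 * h) * (L : ℝ) ^ 2 * dWaveSourceDensity L 0 μ (2 * h) + 2 * U * (L : ℝ) ^ 2 := key
    _ = (2 * dWaveSourceDensity L 0 μ (2 * h) + U / h) * (2 * h * (L : ℝ) ^ 2) := by
        field_simp

/-! ### The free sourced torus: energy gain and pair density -/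

/-- Fock-space dimension bookkeeping: `log |Finset (Orb (FermionTorus 2 L))| = 2L² log 2`. [folklore] -/
theorem log_card_fock (L : ℕ) :
    Real.log (Fintype.card (Finset (Orb (FermionTorus 2 L))) : ℝ) = 2 * (L : ℝ) ^ 2 * Real.log 2 := by
  rw [Fintype.card_finset, card_orb_fermionTorus_two]
  push_cast
  rw [Real.log_pow]
  push_cast
  ring

/-- **Free sourced energy gain** (BdG pressure gain + `e^{-βE₀} ≤ Re Z_β ≤ D e^{-βE₀}`): for
`[μ₁,μ₂] ⊂ (-4,0)` there is `C₀ > 0` with, for `β ≥ 1`, `μ ∈ [μ₁,μ₂]`, eventually in `L`, all sources `s`: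
`E_L(0,μ,0) - E_L(0,μ,s) ≤ (C₀(1 + log β)s² + 2 log 2/β) L²`. [cite: Lieb1994, Remark (iii)] -/
theorem free_gain_le (μ₁ μ₂ : ℝ) (h4 : -4 < μ₁) (h12 : μ₁ ≤ μ₂) (h0 : μ₂ < 0) :
    ∃ C₀ : ℝ, 0 < C₀ ∧ ∀ β : ℝ, 1 ≤ β → ∀ μ ∈ Set.Icc μ₁ μ₂, ∃ L₀ : ℕ, ∀ (L : ℕ) [NeZero L], L₀ ≤ L →
      ∀ s : ℝ, (dWaveSourceTorus L 0 μ 0).groundEnergy - (dWaveSourceTorus L 0 μ s).groundEnergy ≤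
        (C₀ * (1 + Real.log β) * s ^ 2 + 2 * Real.log 2 / β) * (L : ℝ) ^ 2 := by
  obtain ⟨C₀, hC₀, hgain⟩ := dWaveSource_free_sourcedGain_le μ₁ μ₂ h4 h12 h0
  refine ⟨C₀, hC₀, fun β hβ μ hμ => ?_⟩
  obtain ⟨L₀, hL₀⟩ := hgain β hβ μ hμ
  refine ⟨L₀, fun L _ hL s => ?_⟩
  have hβ0 : 0 < β := by linarith
  have hLpos : (0 : ℝ) < (L : ℝ) ^ 2 := cast_sq_pos_of_neZero L
  have hβL : 0 < β * (L : ℝ) ^ 2 := by positivity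
  have key := hL₀ L hL s
  set Hs := dWaveSourceTorus L 0 μ s with hHs
  set H0 := dWaveSourceTorus L 0 μ 0 with hH0
  have hHs_herm : Hs.IsHermitian := dWaveSourceTorus_isHermitian L (isHermitian_hubbardTorusWith L 1 0 μ) s
  have hH0_herm : H0.IsHermitian := dWaveSourceTorus_isHermitian L (isHermitian_hubbardTorusWith L 1 0 μ) 0
  have h1 := exp_neg_mul_groundEnergy_le_partitionFn hHs_herm β
  have h2 := partitionFn_le_card_mul_exp hH0_herm hβ0.le
  have h2' := exp_neg_mul_groundEnergy_le_partitionFn hH0_herm β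
  have hZ0_pos : 0 < (partitionFn β H0).re := lt_of_lt_of_le (Real.exp_pos _) h2'
  have hD : (0 : ℝ) < Fintype.card (Finset (Orb (FermionTorus 2 L))) := by exact_mod_cast Fintype.card_pos
  have hlog1 : -(β * Hs.groundEnergy) ≤ Real.log (partitionFn β Hs).re := by
    have := Real.log_le_log (Real.exp_pos _) h1
    rwa [Real.log_exp] at this
  have hlog2 : Real.log (partitionFn β H0).re ≤ 2 * (L : ℝ) ^ 2 * Real.log 2 + -(β * H0.groundEnergy) := by
    have := Real.log_le_log hZ0_pos h2
    rwa [Real.log_mul hD.ne' (Real.exp_pos _).ne', Real.log_exp, log_card_fock] at this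
  have key' : Real.log (partitionFn β Hs).re - Real.log (partitionFn β H0).re ≤
      C₀ * (1 + Real.log β) * s ^ 2 * (β * (L : ℝ) ^ 2) := by
    rw [← sub_div, div_le_iff₀ hβL] at key
    exact key
  have main : β * (H0.groundEnergy - Hs.groundEnergy) ≤
      C₀ * (1 + Real.log β) * s ^ 2 * (β * (L : ℝ) ^ 2) + 2 * (L : ℝ) ^ 2 * Real.log 2 := by
    linarith
  have : H0.groundEnergy - Hs.groundEnergy ≤
      C₀ * (1 + Real.log β) * s ^ 2 * (L : ℝ) ^ 2 + 2 * (L : ℝ) ^ 2 * Real.log 2 / β := by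
    rw [← sub_nonneg] at main ⊢
    have : (C₀ * (1 + Real.log β) * s ^ 2 * (L : ℝ) ^ 2 + 2 * (L : ℝ) ^ 2 * Real.log 2 / β
        - (H0.groundEnergy - Hs.groundEnergy)) = (C₀ * (1 + Real.log β) * s ^ 2 * (β * (L : ℝ) ^ 2)
        + 2 * (L : ℝ) ^ 2 * Real.log 2 - β * (H0.groundEnergy - Hs.groundEnergy)) / β := by
      field_simp
    rw [this]
    positivity
  calc H0.groundEnergy - Hs.groundEnergy
      ≤ C₀ * (1 + Real.log β) * s ^ 2 * (L : ℝ) ^ 2 + 2 * (L : ℝ) ^ 2 * Real.log 2 / β := this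
    _ = (C₀ * (1 + Real.log β) * s ^ 2 + 2 * Real.log 2 / β) * (L : ℝ) ^ 2 := by ring

/-- Elementary: for `0 < s`, `-(s log s) ≤ 2√s` (from `log y ≤ y - 1` at `y = 1/√s`). [folklore] -/
theorem neg_mul_log_le_two_sqrt {s : ℝ} (hs : 0 < s) : -(s * Real.log s) ≤ 2 * Real.sqrt s := by
  have hsq : Real.sqrt s * Real.sqrt s = s := Real.mul_self_sqrt hs.le
  have hr : 0 < Real.sqrt s := Real.sqrt_pos.2 hs
  have hlog : Real.log s = 2 * Real.log (Real.sqrt s) := by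
    conv_lhs => rw [← hsq]
    rw [Real.log_mul hr.ne' hr.ne']; ring
  have h1 : Real.log (Real.sqrt s)⁻¹ ≤ (Real.sqrt s)⁻¹ - 1 := Real.log_le_sub_one_of_pos (inv_pos.2 hr)
  rw [Real.log_inv] at h1
  have h2 : -(s * Real.log s) = 2 * s * (-Real.log (Real.sqrt s)) := by rw [hlog]; ring
  rw [h2]
  have h3 : -Real.log (Real.sqrt s) ≤ (Real.sqrt s)⁻¹ := by linarith
  calc 2 * s * (-Real.log (Real.sqrt s)) ≤ 2 * s * (Real.sqrt s)⁻¹ :=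
        mul_le_mul_of_nonneg_left h3 (by positivity)
    _ = 2 * Real.sqrt s := by
        field_simp
        nlinarith [hsq]

/-- **The free sourced `d`-wave pair density is `O(√s)`** (crude, `μ`-uniform form of the Cooper law
`∼ s log(1/s)`): for `[μ₁,μ₂] ⊂ (-4,0)` there is `K > 0` such that for all `s ∈ (0,1]`, `μ ∈ [μ₁,μ₂]`,
eventually in `L`: `dWaveSourceDensity L 0 μ s ≤ K√s`. [cite: Salmhofer1999, §4.5.4] -/
theorem free_density_le_sqrt (μ₁ μ₂ : ℝ) (h4 : -4 < μ₁) (h12 : μ₁ ≤ μ₂) (h0 : μ₂ < 0) :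
    ∃ K : ℝ, 0 < K ∧ ∀ s ∈ Set.Ioc (0:ℝ) 1, ∀ μ ∈ Set.Icc μ₁ μ₂, ∃ L₀ : ℕ, ∀ (L : ℕ) [NeZero L], L₀ ≤ L →
      dWaveSourceDensity L 0 μ s ≤ K * Real.sqrt s := by
  obtain ⟨C₀, hC₀, hgain⟩ := free_gain_le μ₁ μ₂ h4 h12 h0
  refine ⟨10 * C₀ + 1, by positivity, fun s hs μ hμ => ?_⟩
  have hs0 : 0 < s := hs.1
  have hs1 : s ≤ 1 := hs.2
  set β : ℝ := (s ^ 2)⁻¹ with hβdef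
  have hs2 : 0 < s ^ 2 := by positivity
  have hβ1 : 1 ≤ β := by
    rw [hβdef, one_le_inv₀ hs2]
    nlinarith
  obtain ⟨L₀, hL₀⟩ := hgain β hβ1 μ hμ
  refine ⟨L₀, fun L _ hL => ?_⟩
  have hLpos : (0 : ℝ) < (L : ℝ) ^ 2 := cast_sq_pos_of_neZero L
  have hd := dWaveSourceDensity_le_energyDrop_div (L := L) 0 μ hs0
  have hE0 := groundEnergy_dWaveSourceTorus_le (L := L) 0 μ s
  have hg := hL₀ L hL (2 * s)
  have hlogβ : Real.log β = -(2 * Real.log s) := by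
    rw [hβdef, Real.log_inv, Real.log_pow]; push_cast; ring
  have hslog : -(s * Real.log s) ≤ 2 * Real.sqrt s := neg_mul_log_le_two_sqrt hs0
  have hsqrt1 : s ≤ Real.sqrt s := by
    calc s = Real.sqrt (s ^ 2) := (Real.sqrt_sq hs0.le).symm
      _ ≤ Real.sqrt s := Real.sqrt_le_sqrt (by nlinarith)
  have hsqrt0 : 0 ≤ Real.sqrt s := Real.sqrt_nonneg s
  have hlog2 : Real.log 2 ≤ 1 := by
    have := Real.log_le_sub_one_of_pos (show (0:ℝ) < 2 by norm_num); linarith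
  have hpos : (0 : ℝ) < 2 * s * (L : ℝ) ^ 2 := by positivity
  have step1 : dWaveSourceDensity L 0 μ s * (2 * s * (L : ℝ) ^ 2) ≤
      (C₀ * (1 + Real.log β) * (2 * s) ^ 2 + 2 * Real.log 2 / β) * (L : ℝ) ^ 2 := by
    rw [le_div_iff₀ hpos] at hd
    linarith
  have hβinv : 2 * Real.log 2 / β = 2 * Real.log 2 * s ^ 2 := by
    rw [hβdef, div_inv_eq_mul]
  rw [hβinv, hlogβ] at step1
  have target : (C₀ * (1 + -(2 * Real.log s)) * (2 * s) ^ 2 + 2 * Real.log 2 * s ^ 2) * (L : ℝ) ^ 2 ≤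
      (10 * C₀ + 1) * Real.sqrt s * (2 * s * (L : ℝ) ^ 2) := by
    have inner : C₀ * (1 + -(2 * Real.log s)) * (2 * s) + Real.log 2 * s ≤ (10 * C₀ + 1) * Real.sqrt s := by
      have e1 : C₀ * (1 + -(2 * Real.log s)) * (2 * s) = 2 * C₀ * s + 4 * C₀ * (-(s * Real.log s)) := by ring
      rw [e1]
      have a1 : 2 * C₀ * s ≤ 2 * C₀ * Real.sqrt s := mul_le_mul_of_nonneg_left hsqrt1 (by positivity)
      have a2 : 4 * C₀ * (-(s * Real.log s)) ≤ 4 * C₀ * (2 * Real.sqrt s) :=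
        mul_le_mul_of_nonneg_left hslog (by positivity)
      have a3 : Real.log 2 * s ≤ 1 * Real.sqrt s :=
        mul_le_mul hlog2 hsqrt1 hs0.le zero_le_one
      linarith
    have := mul_le_mul_of_nonneg_right inner hpos.le
    have e2 : (C₀ * (1 + -(2 * Real.log s)) * (2 * s) ^ 2 + 2 * Real.log 2 * s ^ 2) * (L : ℝ) ^ 2 =
        (C₀ * (1 + -(2 * Real.log s)) * (2 * s) + Real.log 2 * s) * (2 * s * (L : ℝ) ^ 2) := by ring
    rw [e2]
    linarith
  exact le_of_mul_le_mul_right (step1.trans target) hpos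

/-! ### The ceiling on the order parameter; the free torus is orderless -/

/-- Choice of a small source: for `K, ε > 0` some `h ∈ (0, 1/2]` has `2K√(2h) ≤ ε`. [folklore] -/
theorem exists_small_source {K ε : ℝ} (hK : 0 < K) (hε : 0 < ε) :
    ∃ h ∈ Set.Ioc (0:ℝ) (1/2), 2 * K * Real.sqrt (2 * h) ≤ ε := by
  set a : ℝ := ε / (2 * K) with ha
  have ha0 : 0 < a := by positivity
  refine ⟨min (1/2) (a ^ 2 / 2), ⟨lt_min (by norm_num) (by positivity), min_le_left _ _⟩, ?_⟩
  have h2 : 2 * min (1/2) (a ^ 2 / 2) ≤ a ^ 2 := by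
    have := min_le_right (1/2 : ℝ) (a ^ 2 / 2); linarith
  have h3 : Real.sqrt (2 * min (1/2) (a ^ 2 / 2)) ≤ a := by
    calc Real.sqrt (2 * min (1/2) (a ^ 2 / 2)) ≤ Real.sqrt (a ^ 2) := Real.sqrt_le_sqrt h2
      _ = a := Real.sqrt_sq ha0.le
  calc 2 * K * Real.sqrt (2 * min (1/2) (a ^ 2 / 2)) ≤ 2 * K * a :=
        mul_le_mul_of_nonneg_left h3 (by positivity)
    _ = ε := by rw [ha]; field_simp

/-- **The weak-coupling ceiling on the order parameter.** For `[μ₁,μ₂] ⊂ (-4,0)` there is `K > 0` with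
`dWaveOrderParameter U μ ≤ 2K√(2h) + U/h` for all `U ≥ 0`, `μ ∈ [μ₁,μ₂]`, `h ∈ (0,1/2]` (optimising in
`h`, `m(U,μ) = O(U^{1/3})`). [cite: KomaTasaki1994, §1] -/
theorem orderParameter_le_weakCoupling (μ₁ μ₂ : ℝ) (h4 : -4 < μ₁) (h12 : μ₁ ≤ μ₂) (h0 : μ₂ < 0) :
    ∃ K : ℝ, 0 < K ∧ ∀ U : ℝ, 0 ≤ U → ∀ μ ∈ Set.Icc μ₁ μ₂, ∀ h ∈ Set.Ioc (0:ℝ) (1/2),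
      dWaveOrderParameter U μ ≤ 2 * K * Real.sqrt (2 * h) + U / h := by
  obtain ⟨K, hK, hfree⟩ := free_density_le_sqrt μ₁ μ₂ h4 h12 h0
  refine ⟨K, hK, fun U hU μ hμ h hh => ?_⟩
  have hh0 : 0 < h := hh.1
  have h2h : 2 * h ∈ Set.Ioc (0:ℝ) 1 := ⟨by linarith, by linarith [hh.2]⟩
  obtain ⟨L₀, hL₀⟩ := hfree (2 * h) h2h μ hμ
  refine (dWaveOrderParameter_le_liminf U μ hh0).trans ?_
  have hev : ∀ᶠ L : ℕ in atTop, dWaveSourceDensity (L + 1) U μ h ≤ 2 * K * Real.sqrt (2 * h) + U / h := by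
    refine eventually_atTop.2 ⟨L₀, fun L hL => ?_⟩
    have hfL := hL₀ (L + 1) (by omega)
    have := density_le_free (L := L + 1) hU μ hh0
    nlinarith
  refine liminf_le_of_frequently_le hev.frequently ?_
  exact isBoundedUnder_of_eventually_ge (a := 0)
    (Eventually.of_forall fun L => dWaveSourceDensity_nonneg U μ hh0.le)

/-- **The free torus has no `d`-wave Koma–Tasaki order** on the hole-doped band `μ ∈ (-4,0)`:
`dWaveOrderParameter 0 μ = 0` (sub-linear sourced response). [cite: KomaTasaki1994, §1] -/
theorem dWaveOrderParameter_free_eq_zero (μ : ℝ) (hμ : μ ∈ Set.Ioo (-4:ℝ) 0) :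
    dWaveOrderParameter 0 μ = 0 := by
  obtain ⟨K, hK, hle⟩ := orderParameter_le_weakCoupling μ μ hμ.1 le_rfl hμ.2
  refine le_antisymm ?_ (dWaveOrderParameter_nonneg 0 μ)
  by_contra hpos
  push Not at hpos
  obtain ⟨h, hh, hsmall⟩ := exists_small_source hK (half_pos hpos)
  have := hle 0 le_rfl μ ⟨le_rfl, le_rfl⟩ h hh
  rw [zero_div, add_zero] at this
  linarith

/-- Hence `¬ HasDWaveOrder 0 μ` for `μ ∈ (-4,0)`: the coupling `U = 0` is orderless. [cite: KomaTasaki1994, §1] -/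
theorem not_hasDWaveOrder_free (μ : ℝ) (hμ : μ ∈ Set.Ioo (-4:ℝ) 0) : ¬ HasDWaveOrder 0 μ := by
  rw [hasDWaveOrder_iff, dWaveOrderParameter_free_eq_zero μ hμ]
  exact lt_irrefl 0

/-- **Uniform vanishing at weak coupling**: for `[μ₁,μ₂] ⊂ (-4,0)` and every `ε > 0` there is `U₀ > 0`
with `dWaveOrderParameter U μ ≤ ε` for ALL `U ∈ [0,U₀)` and ALL `μ ∈ [μ₁,μ₂]`. [cite: KomaTasaki1994, §1] -/
theorem orderParameter_small_of_weakCoupling (μ₁ μ₂ : ℝ) (h4 : -4 < μ₁) (h12 : μ₁ ≤ μ₂) (h0 : μ₂ < 0)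
    {ε : ℝ} (hε : 0 < ε) :
    ∃ U₀ : ℝ, 0 < U₀ ∧ ∀ U ∈ Set.Ico (0:ℝ) U₀, ∀ μ ∈ Set.Icc μ₁ μ₂, dWaveOrderParameter U μ ≤ ε := by
  obtain ⟨K, hK, hle⟩ := orderParameter_le_weakCoupling μ₁ μ₂ h4 h12 h0
  obtain ⟨h, hh, hsmall⟩ := exists_small_source hK (half_pos hε)
  have hh0 : 0 < h := hh.1
  refine ⟨ε * h / 2, by positivity, fun U hU μ hμ => ?_⟩
  have h1 := hle U hU.1 μ hμ h hh
  have h2 : U / h ≤ ε / 2 := by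
    rw [div_le_iff₀ hh0]
    have := hU.2
    linarith
  linarith

/-! ### Two natural strengthenings of the crux's window, refuted -/

/-- **FALSE: the window with the coupling interval closed at `U = 0`** (chemical potentials on a compact of
the hole-doped free band): at `U = 0` no `μ ∈ (-4,0)` carries `d`-wave order. The open endpoint `0 < U` of
`NodalReduction`'s window is load-bearing. [cite: KomaTasaki1994, §1] -/
theorem window_false_fromZero {μ₁ μ₂ : ℝ} (h4 : -4 < μ₁) (h0 : μ₂ < 0) :
    ¬ (∃ U₀ : ℝ, 0 < U₀ ∧ ∀ U ∈ Set.Ico (0:ℝ) U₀, ∃ μ ∈ Set.Icc μ₁ μ₂, HasDWaveOrder U μ) := by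
  rintro ⟨U₀, hU₀, hw⟩
  obtain ⟨μ, hμ, hord⟩ := hw 0 ⟨le_rfl, hU₀⟩
  exact not_hasDWaveOrder_free μ ⟨lt_of_lt_of_le h4 hμ.1, lt_of_le_of_lt hμ.2 h0⟩ hord

/-- **FALSE: a `U`-uniform floor on the order parameter across the window** (`∃ m₀ > 0 ∃ U₀ > 0 ∀ U ∈ (0,U₀)
∃ μ ∈ [μ₁,μ₂], m₀ ≤ m(U,μ)`, any `[μ₁,μ₂] ⊂ (-4,0)`): the order parameter is `≤ ε` for all `U < U₀(ε)`
uniformly in `μ`. So the window of `NodalReduction`, if true, is a window of parametrically WEAK order: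
`m(U,μ_U) → 0` as `U → 0⁺` is forced. [cite: KomaTasaki1994, §1] -/
theorem window_false_uniformOrder {μ₁ μ₂ : ℝ} (h4 : -4 < μ₁) (h12 : μ₁ ≤ μ₂) (h0 : μ₂ < 0) :
    ¬ (∃ m₀ : ℝ, 0 < m₀ ∧ ∃ U₀ : ℝ, 0 < U₀ ∧ ∀ U ∈ Set.Ioo (0:ℝ) U₀, ∃ μ ∈ Set.Icc μ₁ μ₂,
        m₀ ≤ dWaveOrderParameter U μ) := by
  rintro ⟨m₀, hm₀, U₀, hU₀, hw⟩
  obtain ⟨U₁, hU₁, hsmall⟩ := orderParameter_small_of_weakCoupling μ₁ μ₂ h4 h12 h0 (half_pos hm₀)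
  have hm : 0 < min U₀ U₁ := lt_min hU₀ hU₁
  obtain ⟨μ, hμ, hfloor⟩ := hw (min U₀ U₁ / 2)
    ⟨half_pos hm, lt_of_lt_of_le (half_lt_self hm) (min_le_left _ _)⟩
  have hle := hsmall (min U₀ U₁ / 2)
    ⟨(half_pos hm).le, lt_of_lt_of_le (half_lt_self hm) (min_le_right _ _)⟩ μ hμ
  linarith

end Summit.HubbardSuperconductivity.HubbardSuperconductivity.Theorems.NodalReduction.Negative
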